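import Summits.NavierStokesRegularity.NavierStokesRegularity.Theses.TypeICertificateLadder
import Literature.Analysis.FluidPDE.NSCriticalClosureBesovKatoClass

/-!
# Route TypeICertificateLadder — crux `NoTypeII` (item stmt-NavierStokesRegularity-0056):
# the Seregin dictionary (singular time, Type II blow-up) and the rung form

`NoTypeII` says: a finite-energy classical solution of unforced Navier–Stokes on `ℝ³ × [0, T)` from
a rapidly decaying datum with MAXIMAL lifespan `T` (`IsMaximalSmoothSolution`: no classical
continuation past `T`) blows up at most at the self-similar rate, `‖u(t)‖_∞ ≤ C (T − t)^{-1/2}`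
eventually (`IsTypeIBlowup`). It is the open "no Type II blow-up" problem (Koch–Nadirashvili–
Seregin–Šverák 2009, p. 4; Seregin 2012, §1); its negation is a finite-energy Type II singularity,
i.e. a counterexample to Clay (A). This file does not settle it. It records, sorry-free, the
dictionary between the route statement and the Literature vocabulary of
`Literature/Analysis/FluidPDE/SuitableWeak.lean` (`IsRegularPoint`, `IsSingularTime`,
`IsTypeIIBlowup`, Seregin 2012, §1), using the tree's theorem "a finite maximal time carries a
singular point" (`exists_singularPoint_of_classical_of_not_hasSmoothExtensionPast`,
Lemarié-Rieusset 2016, Thm. 15.1 (C)):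

* `exists_not_isRegularPoint_of_isMaximalSmoothSolution`, `isSingularTime_of_isMaximalSmoothSolution`
  — a maximal classical Leray–Hopf solution from a rapidly decaying datum has a CKN-singular point
  `(T, x₀)`, so `T` is a singular time;
* `isTypeIBlowup_or_isTypeIIBlowup_of_isMaximalSmoothSolution` — hence the Type I / Type II
  dichotomy at `T` is exhaustive for such solutions;
* `noTypeII_iff_forall_not_isTypeIIBlowup` — `NoTypeII` ↔ no such solution is a Type II blow-up
  in the sense of `IsTypeIIBlowup` (singular time ∧ ¬ Type I rate);
* `not_noTypeII_iff_exists_isTypeIIBlowup` — the refutation target made explicit: `¬ NoTypeII` ↔ a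
  finite-energy Type II singularity from a rapidly decaying datum exists;
* `noTypeII_iff_forall_exists_rung` — the dimensionless (rung) form used by the ladder: `NoTypeII` ↔
  every such solution satisfies `√(T − t) ‖u(t, x)‖ ≤ C √ν` eventually for some `C > 0`, i.e. sits
  on some rung `X_C` of `LadderGlue`.
-/

noncomputable section

namespace Summit.NavierStokesRegularity.NavierStokesRegularity.Theorems

open MeasureTheory Set Function Filter Topology Metric
open Literature.Analysis.FluidPDE
open Summit.NavierStokesRegularity.NavierStokesRegularity.Theses.TypeICertificateLadder (NoTypeII)
open scoped ENNReal

/-- **A maximal lifespan carries a CKN-singular point.** For `ν > 0`, `T > 0` and a maximal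
classical solution `(u, p)` of unforced Navier–Stokes on `ℝ³ × [0, T)` (no classical continuation
past `T`) which is Leray–Hopf from its rapidly decaying datum, some point `(T, x₀)` is not a
regular point of `u`: `u` is essentially unbounded on every centred parabolic cylinder
`Q*_r(T, x₀)` (it is already unbounded on the backward halves `Q_r(T, x₀)`, by the tree's
`exists_singularPoint_of_classical_of_not_hasSmoothExtensionPast`, Lemarié-Rieusset 2016,
Thm. 15.1 (C), and `Q_r ⊆ Q*_r`). [cite: LemarieRieusset2016, Thm. 15.1 (C)] -/
theorem exists_not_isRegularPoint_of_isMaximalSmoothSolution {ν T : ℝ} (hν : 0 < ν) (hT : 0 < T)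
    {u : ℝ → EuclideanSpace ℝ (Fin 3) → EuclideanSpace ℝ (Fin 3)}
    {p : ℝ → EuclideanSpace ℝ (Fin 3) → ℝ}
    (hmax : IsMaximalSmoothSolution ν 0 u p T) (hLH : IsLerayHopfOn T ν 0 (u 0) u)
    (hdec : HasRapidSpatialDecay (u 0)) :
    ∃ x₀ : EuclideanSpace ℝ (Fin 3), ¬ IsRegularPoint u ((T : ℝ), x₀) := by
  obtain ⟨x₀, hx₀⟩ :=
    exists_singularPoint_of_classical_of_not_hasSmoothExtensionPast hν hT hmax.1 hLH hdec hmax.2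
  refine ⟨x₀, ?_⟩
  rintro ⟨r, hr, hfin⟩
  have hsub : parabolicCylinder r ((T : ℝ), x₀) ⊆ parabolicCylinderCentered r ((T : ℝ), x₀) := by
    intro w hw
    rw [mem_parabolicCylinder] at hw
    rw [mem_parabolicCylinderCentered]
    refine ⟨⟨hw.1.1, ?_⟩, hw.2⟩
    have : (0 : ℝ) < r ^ 2 := by positivity
    exact hw.1.2.trans (by simpa using this)
  have hle : eLpNorm (uncurry u) ∞ (volume.restrict (parabolicCylinder r ((T : ℝ), x₀))) ≤
      eLpNorm (uncurry u) ∞ (volume.restrict (parabolicCylinderCentered r ((T : ℝ), x₀))) :=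
    eLpNorm_mono_measure _ (Measure.restrict_mono hsub le_rfl)
  exact ((hle.trans_lt hfin).ne) (eLpNorm_top_parabolicCylinder_eq_top_of_small hT hx₀ hr)

/-- **A maximal lifespan is a singular time** (Seregin 2012, §1: `T` is a blow-up time iff some
`(T, x)` is singular): immediate from `exists_not_isRegularPoint_of_isMaximalSmoothSolution`.
[cite: Seregin2012, §1] -/
theorem isSingularTime_of_isMaximalSmoothSolution {ν T : ℝ} (hν : 0 < ν) (hT : 0 < T)
    {u : ℝ → EuclideanSpace ℝ (Fin 3) → EuclideanSpace ℝ (Fin 3)}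
    {p : ℝ → EuclideanSpace ℝ (Fin 3) → ℝ}
    (hmax : IsMaximalSmoothSolution ν 0 u p T) (hLH : IsLerayHopfOn T ν 0 (u 0) u)
    (hdec : HasRapidSpatialDecay (u 0)) : IsSingularTime u T :=
  exists_not_isRegularPoint_of_isMaximalSmoothSolution hν hT hmax hLH hdec

/-- **The Type I / Type II dichotomy is exhaustive at a maximal time** (Seregin 2012, §1): a maximal
classical Leray–Hopf solution from a rapidly decaying datum blows up at `T` either at the Type I
rate (`IsTypeIBlowup`) or as a Type II blow-up (`IsTypeIIBlowup` = singular time ∧ ¬ Type I), the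
time `T` being singular by `isSingularTime_of_isMaximalSmoothSolution`. [cite: Seregin2012, §1] -/
theorem isTypeIBlowup_or_isTypeIIBlowup_of_isMaximalSmoothSolution {ν T : ℝ} (hν : 0 < ν)
    (hT : 0 < T) {u : ℝ → EuclideanSpace ℝ (Fin 3) → EuclideanSpace ℝ (Fin 3)}
    {p : ℝ → EuclideanSpace ℝ (Fin 3) → ℝ}
    (hmax : IsMaximalSmoothSolution ν 0 u p T) (hLH : IsLerayHopfOn T ν 0 (u 0) u)
    (hdec : HasRapidSpatialDecay (u 0)) : IsTypeIBlowup u T ∨ IsTypeIIBlowup u T := by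
  by_cases hI : IsTypeIBlowup u T
  · exact Or.inl hI
  · exact Or.inr ⟨isSingularTime_of_isMaximalSmoothSolution hν hT hmax hLH hdec, hI⟩

/-- **`NoTypeII` in Seregin's vocabulary.** The route statement `NoTypeII` (item
stmt-NavierStokesRegularity-0056) is equivalent to: no maximal classical Leray–Hopf solution from a
rapidly decaying datum is a Type II blow-up at its lifespan `T` in the sense of
`IsTypeIIBlowup u T` (= `IsSingularTime u T ∧ ¬ IsTypeIBlowup u T`, Seregin 2012, §1). The forward
direction is logic; the backward one uses that a maximal time is singular
(`isSingularTime_of_isMaximalSmoothSolution`). [cite: Seregin2012, §1] -/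
theorem noTypeII_iff_forall_not_isTypeIIBlowup :
    NoTypeII ↔ ∀ (ν T : ℝ), 0 < ν → 0 < T →
      ∀ (u : ℝ → EuclideanSpace ℝ (Fin 3) → EuclideanSpace ℝ (Fin 3))
        (p : ℝ → EuclideanSpace ℝ (Fin 3) → ℝ),
        IsMaximalSmoothSolution ν 0 u p T → IsLerayHopfOn T ν 0 (u 0) u →
        HasRapidSpatialDecay (u 0) → ¬ IsTypeIIBlowup u T := by
  unfold NoTypeII
  constructor
  · intro h ν T hν hT u p hmax hLH hdec hII
    exact hII.2 (h ν T hν hT u p hmax hLH hdec)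
  · intro h ν T hν hT u p hmax hLH hdec
    rcases isTypeIBlowup_or_isTypeIIBlowup_of_isMaximalSmoothSolution hν hT hmax hLH hdec with hI | hII
    · exact hI
    · exact absurd hII (h ν T hν hT u p hmax hLH hdec)

/-- **The refutation target of `NoTypeII`, made explicit.** `NoTypeII` fails iff there is a
finite-energy Type II singularity from a rapidly decaying datum: some `ν > 0`, `T > 0` and a
maximal classical solution `(u, p)` on `ℝ³ × [0, T)`, Leray–Hopf from its rapidly decaying datum,
with `IsTypeIIBlowup u T` (Seregin 2012, §1; Koch–Nadirashvili–Seregin–Šverák 2009, p. 4: such a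
solution is a counterexample to Clay (A)). [cite: Seregin2012, §1] -/
theorem not_noTypeII_iff_exists_isTypeIIBlowup :
    ¬ NoTypeII ↔ ∃ (ν T : ℝ) (u : ℝ → EuclideanSpace ℝ (Fin 3) → EuclideanSpace ℝ (Fin 3))
      (p : ℝ → EuclideanSpace ℝ (Fin 3) → ℝ), 0 < ν ∧ 0 < T ∧
        IsMaximalSmoothSolution ν 0 u p T ∧ IsLerayHopfOn T ν 0 (u 0) u ∧
        HasRapidSpatialDecay (u 0) ∧ IsTypeIIBlowup u T := by
  rw [noTypeII_iff_forall_not_isTypeIIBlowup]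
  constructor
  · intro h
    by_contra hne
    apply h
    intro ν T hν hT u p hmax hLH hdec hII
    exact hne ⟨ν, T, u, p, hν, hT, hmax, hLH, hdec, hII⟩
  · rintro ⟨ν, T, u, p, hν, hT, hmax, hLH, hdec, hII⟩ h
    exact h ν T hν hT u p hmax hLH hdec hII

/-- **Rung form of `NoTypeII`.** `NoTypeII` is equivalent to: every maximal classical Leray–Hopf
solution from a rapidly decaying datum sits on SOME rung of the ladder, i.e. for some `C > 0` the
dimensionless rate `√(T − t) ‖u(t, x)‖ ≤ C √ν` holds for all `x` and all `t < T` near `T` (the rung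
hypothesis of `LadderGlue` / `RungReynoldsOne`; Leray 1934, §19, (3.9) for the matching lower
bound). Conversion: `‖u‖ ≤ C'/√(T−t)` ⇔ `√(T−t)‖u‖ ≤ C'`, with `C = max C' 1 / √ν`, resp.
`C' = C √ν`. [cite: Leray1934, §19 (3.9)] -/
theorem noTypeII_iff_forall_exists_rung :
    NoTypeII ↔ ∀ (ν T : ℝ), 0 < ν → 0 < T →
      ∀ (u : ℝ → EuclideanSpace ℝ (Fin 3) → EuclideanSpace ℝ (Fin 3))
        (p : ℝ → EuclideanSpace ℝ (Fin 3) → ℝ),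
        IsMaximalSmoothSolution ν 0 u p T → IsLerayHopfOn T ν 0 (u 0) u →
        HasRapidSpatialDecay (u 0) →
        ∃ C : ℝ, 0 < C ∧ ∀ᶠ t in 𝓝[<] T, ∀ x, Real.sqrt (T - t) * ‖u t x‖ ≤ C * Real.sqrt ν := by
  unfold NoTypeII
  constructor
  · intro h ν T hν hT u p hmax hLH hdec
    obtain ⟨C', hC'⟩ := h ν T hν hT u p hmax hLH hdec
    have hsν : 0 < Real.sqrt ν := Real.sqrt_pos.2 hν
    refine ⟨max C' 1 / Real.sqrt ν, by positivity, ?_⟩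
    filter_upwards [hC', self_mem_nhdsWithin] with t ht htT
    intro x
    have hpos : 0 < Real.sqrt (T - t) := Real.sqrt_pos.2 (sub_pos.2 htT)
    have h1 : ‖u t x‖ ≤ C' / Real.sqrt (T - t) := ht x
    calc Real.sqrt (T - t) * ‖u t x‖ ≤ Real.sqrt (T - t) * (C' / Real.sqrt (T - t)) :=
          mul_le_mul_of_nonneg_left h1 hpos.le
      _ = C' := mul_div_cancel₀ C' hpos.ne'
      _ ≤ max C' 1 := le_max_left _ _
      _ = max C' 1 / Real.sqrt ν * Real.sqrt ν := (div_mul_cancel₀ _ hsν.ne').symm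
  · intro h ν T hν hT u p hmax hLH hdec
    obtain ⟨C, -, hC⟩ := h ν T hν hT u p hmax hLH hdec
    refine ⟨C * Real.sqrt ν, ?_⟩
    filter_upwards [hC, self_mem_nhdsWithin] with t ht htT
    intro x
    have hpos : 0 < Real.sqrt (T - t) := Real.sqrt_pos.2 (sub_pos.2 htT)
    rw [le_div_iff₀ hpos, mul_comm]
    exact ht x

end Summit.NavierStokesRegularity.NavierStokesRegularity.Theorems
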